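import Summits.NavierStokesRegularity.NavierStokesRegularity.Theorems.ExtremiserTransienceNearExtremalTransienceExtremiserLiouvilleConstantSpeedSlideEnstrophyPlanar
import HarnessLib

/-!
# Crux `ExtremiserTransience.NearExtremalTransience` (stmt-NavierStokesRegularity-21883), line `extremiser_liouville`,
# stub K1b — THE `W′`-LINE OF (INEQ)₃ IN MANIFESTLY COERCIVE FORM (record §15/§17, input of R6b)

`--supports stmt-NavierStokesRegularity-21883` (helper).  Author: prover seat `ns-el-k1b` (g9).

The enstrophy variation in `slideInequality_layer` (`…ConstantSpeedSlideInequalityLayer`, p738561) carries the `g′`-weighted density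
`(3/2)|∂₂V_h|² + ½ω₂² − ½|∇_hV₂|² − ⟪∇_hV₂, ∂₂V_h⟫`.  By the planar enstrophy identity `∫wω₂² = ∫w|∇_hV_h|² − ∫w(∂₂V₂)²`
(`integral_axialWeight_curl_two_sq_eq`, p737286, divergence-free `V`) the vorticity square is replaced by the full horizontal gradient of `V_h`:
```
  ∫w[(3/2)|∂₂V_h|² + ½ω₂² − ½|∇_hV₂|² − ⟪∇_hV₂,∂₂V_h⟫] = ∫w[(3/2)|∂₂V_h|² + ½|∇_hV_h|² − ½(∂₂V₂)² − ½|∇_hV₂|² − ⟪∇_hV₂,∂₂V_h⟫],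
```
so that, with the two further `W′`-terms `2∫w(∂₂V₂)²`, `2∫w⟪∇_hV₂,∂₂V_h⟫` of (INEQ)₃, the `W′`-line is a quadratic form in `DV` whose only
indefinite entries involve `∇_hV₂` (small on the far layer of a jet, record §3).  Integrand shapes are those of `slideInequality_layer` verbatim.
* `enstrophyVariation_axial_eq_coercive` : the displayed identity (`w ∈ C¹` bounded, `w = 0` off `[−T, T]`, `D¹V ∈ L²`, slab-integrable `V`).

WHAT THIS IS NOT: K1b is NOT proved; nothing here proves NS regularity. [folklore]
-/

noncomputable section

open Set Filter Topology MeasureTheory Metric Function InnerProductSpace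
open scoped ENNReal NNReal Topology InnerProductSpace RealInnerProductSpace ContDiff
open Literature.Analysis.FluidPDE Literature.Analysis

namespace Summit.NavierStokesRegularity.NavierStokesRegularity.Theorems

-- the problem directory repeats the summit name (`NavierStokesRegularity/NavierStokesRegularity`)
set_option linter.dupNamespace false

namespace ExtremiserLiouville

open DepletionLadder.KStar

variable {V : EuclideanSpace ℝ (Fin 3) → EuclideanSpace ℝ (Fin 3)} {w : ℝ → ℝ}

/-- **The `W′`-density of (INEQ)₃ in coercive form**: for a divergence-free `V ∈ C^∞(ℝ³)` with `D¹V ∈ L²` and square-integrable slabs, and an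
axial weight `w ∈ C¹`, bounded, vanishing for `|s| > T`,
`∫w[(3/2)|∂₂V_h|² + ½ω₂² − ½|∇_hV₂|² − ⟪∇_hV₂,∂₂V_h⟫] = ∫w[(3/2)|∂₂V_h|² + ½|∇_hV_h|² − ½(∂₂V₂)² − ½|∇_hV₂|² − ⟪∇_hV₂,∂₂V_h⟫]`
(`integral_axialWeight_curl_two_sq_eq`). [folklore] -/
theorem enstrophyVariation_axial_eq_coercive (hV : ContDiff ℝ ∞ V) (hdiv : VectorCalculus.IsDivFree V) (hw : ContDiff ℝ 1 w) {K T : ℝ}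
    (hwK : ∀ s, |w s| ≤ K) (hwT : ∀ s, T < |s| → w s = 0)
    (h1 : ∫⁻ x, ‖iteratedFDeriv ℝ 1 V x‖ₑ ^ 2 < ⊤)
    (hslab : Integrable (fun x => {x : EuclideanSpace ℝ (Fin 3) | |x 2| ≤ T}.indicator (fun x => ‖V x‖ ^ 2) x) volume) :
    (∫ x, w (x 2) * ((3 / 2) * (fderiv ℝ V x (EuclideanSpace.single (2 : Fin 3) (1 : ℝ)) 0 ^ 2 + fderiv ℝ V x (EuclideanSpace.single (2 : Fin 3) (1 : ℝ)) 1 ^ 2) + (1 / 2) * curl V x 2 ^ 2 - (1 / 2) * (fderiv ℝ V x (EuclideanSpace.single (0 : Fin 3) (1 : ℝ)) 2 ^ 2 + fderiv ℝ V x (EuclideanSpace.single (1 : Fin 3) (1 : ℝ)) 2 ^ 2) - (fderiv ℝ V x (EuclideanSpace.single (0 : Fin 3) (1 : ℝ)) 2 * fderiv ℝ V x (EuclideanSpace.single (2 : Fin 3) (1 : ℝ)) 0 + fderiv ℝ V x (EuclideanSpace.single (1 : Fin 3) (1 : ℝ)) 2 * fderiv ℝ V x (EuclideanSpace.single (2 :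 Fin 3) (1 : ℝ)) 1))) =
      ∫ x, w (x 2) * ((3 / 2) * (fderiv ℝ V x (EuclideanSpace.single (2 : Fin 3) (1 : ℝ)) 0 ^ 2 + fderiv ℝ V x (EuclideanSpace.single (2 : Fin 3) (1 : ℝ)) 1 ^ 2) + (1 / 2) * (fderiv ℝ V x (EuclideanSpace.single (0 : Fin 3) (1 : ℝ)) 0 ^ 2 + fderiv ℝ V x (EuclideanSpace.single (1 : Fin 3) (1 : ℝ)) 0 ^ 2 + fderiv ℝ V x (EuclideanSpace.single (0 : Fin 3) (1 : ℝ)) 1 ^ 2 + fderiv ℝ V x (EuclideanSpace.single (1 : Fin 3) (1 : ℝ)) 1 ^ 2) - (1 / 2) * fderiv ℝ V x (EuclideanSpace.single (2 : Fin 3) (1 : ℝ)) 2 ^ 2 - (1 / 2) * (fderiv ℝ V x (EuclideanSpace.single (0 : Fin 3) (1 : ℝ)) 2 ^ 2 + fderiv ℝ V x (EuclideanSpace.single (1 : Fin 3) (1 : ℝ)) 2 ^ 2) - (fderiv ℝ V x (EuclideanSpace.single (0 : Fin 3) (1 : ℝ)) 2 * fderiv ℝ V x (EuclideanSpace.single (2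 : Fin 3) (1 : ℝ)) 0 + fderiv ℝ V x (EuclideanSpace.single (1 : Fin 3) (1 : ℝ)) 2 * fderiv ℝ V x (EuclideanSpace.single (2 : Fin 3) (1 : ℝ)) 1)) := by
  have hK0 : 0 ≤ K := (abs_nonneg _).trans (hwK 0)
  have hplanar := integral_axialWeight_curl_two_sq_eq hV hdiv hw hwK hwT h1 hslab
  -- `DV ∈ L²`
  have hD1 : Integrable (fun x => ‖iteratedFDeriv ℝ 1 V x‖ ^ 2) (volume : Measure (EuclideanSpace ℝ (Fin 3))) :=
    integrable_sq_norm_of_lintegral (hV.continuous_iteratedFDeriv (WithTop.coe_le_coe.mpr le_top)) h1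
  have i1 : Integrable (fun x => ‖fderiv ℝ V x‖ ^ 2) (volume : Measure (EuclideanSpace ℝ (Fin 3))) :=
    hD1.congr (Eventually.of_forall fun x => by simp only; rw [← norm_iteratedFDeriv_fderiv, norm_iteratedFDeriv_zero])
  -- continuity and pointwise bounds of the entries of `DV`
  have cw : Continuous fun x : EuclideanSpace ℝ (Fin 3) => w (x 2) := hw.continuous.comp (PiLp.continuous_apply 2 _ (2 : Fin 3))
  have hDi : ∀ (v : EuclideanSpace ℝ (Fin 3)) (i : Fin 3), Continuous fun y => fderiv ℝ V y v i := fun v i =>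
    ((EuclideanSpace.proj i : EuclideanSpace ℝ (Fin 3) →L[ℝ] ℝ).contDiff.comp
      ((hV.fderiv_right (m := ∞) (by exact_mod_cast le_rfl)).clm_apply contDiff_const)).continuous
  have hcurl2 : Continuous fun y => curl V y 2 :=
    (EuclideanSpace.proj (2 : Fin 3) : EuclideanSpace ℝ (Fin 3) →L[ℝ] ℝ).continuous.comp
      (contDiff_curl (n := ⊤) hV).continuous
  have ns : ∀ a : Fin 3, ‖EuclideanSpace.single a (1 : ℝ)‖ = 1 := fun a => by
    rw [PiLp.norm_single, norm_one]
  have bd : ∀ (x : EuclideanSpace ℝ (Fin 3)) (a i : Fin 3), |fderiv ℝ V x (EuclideanSpace.single a (1 : ℝ)) i| ≤ ‖fderiv ℝ V x‖ := fun x a i => by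
    have h1' : |fderiv ℝ V x (EuclideanSpace.single a (1 : ℝ)) i| ≤ ‖fderiv ℝ V x (EuclideanSpace.single a (1 : ℝ))‖ := by
      simpa [Real.norm_eq_abs] using PiLp.norm_apply_le (fderiv ℝ V x (EuclideanSpace.single a (1 : ℝ))) i
    refine h1'.trans ?_
    simpa [ns a] using (fderiv ℝ V x).le_opNorm (EuclideanSpace.single a (1 : ℝ))
  -- integrability of the weighted quadratic monomials in `DV`
  have hpr : ∀ a i b j : Fin 3, Integrable (fun x : EuclideanSpace ℝ (Fin 3) => w (x 2) *
      (fderiv ℝ V x (EuclideanSpace.single a (1 : ℝ)) i * fderiv ℝ V x (EuclideanSpace.single b (1 : ℝ)) j)) volume := by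
    intro a i b j
    refine (i1.const_mul K).mono' (cw.mul ((hDi _ _).mul (hDi _ _))).aestronglyMeasurable (Eventually.of_forall fun x => ?_)
    rw [Real.norm_eq_abs, abs_mul, abs_mul]
    have hP := norm_nonneg (fderiv ℝ V x)
    calc |w (x 2)| * (|fderiv ℝ V x (EuclideanSpace.single a (1 : ℝ)) i| * |fderiv ℝ V x (EuclideanSpace.single b (1 : ℝ)) j|)
        ≤ K * (‖fderiv ℝ V x‖ * ‖fderiv ℝ V x‖) :=
          mul_le_mul (hwK _) (mul_le_mul (bd x a i) (bd x b j) (abs_nonneg _) hP) (by positivity) hK0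
      _ = K * ‖fderiv ℝ V x‖ ^ 2 := by ring
  have hsq : ∀ a i : Fin 3, Integrable (fun x : EuclideanSpace ℝ (Fin 3) => w (x 2) * fderiv ℝ V x (EuclideanSpace.single a (1 : ℝ)) i ^ 2) volume :=
    fun a i => (hpr a i a i).congr (Eventually.of_forall fun x => by simp only; ring)
  have hω : Integrable (fun x : EuclideanSpace ℝ (Fin 3) => w (x 2) * curl V x 2 ^ 2) volume := by
    have h := ((hsq 0 1).add (hsq 1 0)).sub ((hpr 0 1 1 0).const_mul 2)
    refine h.congr (Eventually.of_forall fun x => ?_)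
    simp only [Pi.add_apply, Pi.sub_apply, curl_apply_two]
    ring
  -- the two integrands are integrable
  have iL : Integrable (fun x : EuclideanSpace ℝ (Fin 3) => w (x 2) * ((3 / 2) * (fderiv ℝ V x (EuclideanSpace.single (2 : Fin 3) (1 : ℝ)) 0 ^ 2 + fderiv ℝ V x (EuclideanSpace.single (2 : Fin 3) (1 : ℝ)) 1 ^ 2) + (1 / 2) * curl V x 2 ^ 2 - (1 / 2) * (fderiv ℝ V x (EuclideanSpace.single (0 : Fin 3) (1 : ℝ)) 2 ^ 2 + fderiv ℝ V x (EuclideanSpace.single (1 : Fin 3) (1 : ℝ)) 2 ^ 2) - (fderiv ℝ V x (EuclideanSpace.single (0 : Fin 3) (1 : ℝ)) 2 * fderiv ℝ V x (EuclideanSpace.single (2 : Fin 3) (1 : ℝ)) 0 + fderiv ℝ V x (EuclideanSpace.single (1 : Fin 3) (1 : ℝ)) 2 * fderiv ℝ V x (EuclideanSpace.single (2 : Fin 3) (1 : ℝ)) 1))) volume := by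
    have h := ((((hsq 2 0).add (hsq 2 1)).const_mul (3 / 2)).add (hω.const_mul (1 / 2))).sub
      ((((hsq 0 2).add (hsq 1 2)).const_mul (1 / 2)).add ((hpr 0 2 2 0).add (hpr 1 2 2 1)))
    refine h.congr (Eventually.of_forall fun x => ?_)
    simp only [Pi.add_apply, Pi.sub_apply]
    ring
  have iR : Integrable (fun x : EuclideanSpace ℝ (Fin 3) => w (x 2) * ((3 / 2) * (fderiv ℝ V x (EuclideanSpace.single (2 : Fin 3) (1 : ℝ)) 0 ^ 2 + fderiv ℝ V x (EuclideanSpace.single (2 : Fin 3) (1 : ℝ)) 1 ^ 2) + (1 / 2) * (fderiv ℝ V x (EuclideanSpace.single (0 : Fin 3) (1 : ℝ)) 0 ^ 2 + fderiv ℝ V x (EuclideanSpace.single (1 : Fin 3) (1 : ℝ)) 0 ^ 2 + fderiv ℝ V x (EuclideanSpace.single (0 : Fin 3) (1 : ℝ)) 1 ^ 2 + fderiv ℝ V x (EuclideanSpace.single (1 : Fin 3) (1 : ℝ)) 1 ^ 2) - (1 / 2) * fderiv ℝ V x (EuclideanSpace.single (2 : Fin 3) (1 : ℝ)) 2 ^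 2 - (1 / 2) * (fderiv ℝ V x (EuclideanSpace.single (0 : Fin 3) (1 : ℝ)) 2 ^ 2 + fderiv ℝ V x (EuclideanSpace.single (1 : Fin 3) (1 : ℝ)) 2 ^ 2) - (fderiv ℝ V x (EuclideanSpace.single (0 : Fin 3) (1 : ℝ)) 2 * fderiv ℝ V x (EuclideanSpace.single (2 : Fin 3) (1 : ℝ)) 0 + fderiv ℝ V x (EuclideanSpace.single (1 : Fin 3) (1 : ℝ)) 2 * fderiv ℝ V x (EuclideanSpace.single (2 : Fin 3) (1 : ℝ)) 1))) volume := by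
    have h := (((((hsq 2 0).add (hsq 2 1)).const_mul (3 / 2)).add
      ((((hsq 0 0).add (hsq 1 0)).add ((hsq 0 1).add (hsq 1 1))).const_mul (1 / 2))).sub ((hsq 2 2).const_mul (1 / 2))).sub
      ((((hsq 0 2).add (hsq 1 2)).const_mul (1 / 2)).add ((hpr 0 2 2 0).add (hpr 1 2 2 1)))
    refine h.congr (Eventually.of_forall fun x => ?_)
    simp only [Pi.add_apply, Pi.sub_apply]
    ring
  have i4 : Integrable (fun x : EuclideanSpace ℝ (Fin 3) => w (x 2) * (fderiv ℝ V x (EuclideanSpace.single (0 : Fin 3) (1 : ℝ)) 0 ^ 2 + fderiv ℝ V x (EuclideanSpace.single (1 : Fin 3) (1 : ℝ)) 0 ^ 2 + fderiv ℝ V x (EuclideanSpace.single (0 : Fin 3) (1 : ℝ)) 1 ^ 2 + fderiv ℝ V x (EuclideanSpace.single (1 : Fin 3) (1 : ℝ)) 1 ^ 2)) volume :=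
    (((hsq 0 0).add (hsq 1 0)).add ((hsq 0 1).add (hsq 1 1))).congr (Eventually.of_forall fun x => by
      simp only [Pi.add_apply]; ring)
  -- the difference of the two integrands is `½w(ω₂² − |∇_hV_h|² + (∂₂V₂)²)`, which integrates to zero
  have e1 : (∫ x, w (x 2) * ((3 / 2) * (fderiv ℝ V x (EuclideanSpace.single (2 : Fin 3) (1 : ℝ)) 0 ^ 2 + fderiv ℝ V x (EuclideanSpace.single (2 : Fin 3) (1 : ℝ)) 1 ^ 2) + (1 / 2) * curl V x 2 ^ 2 - (1 / 2) * (fderiv ℝ V x (EuclideanSpace.single (0 : Fin 3) (1 : ℝ)) 2 ^ 2 + fderiv ℝ V x (EuclideanSpace.single (1 : Fin 3) (1 : ℝ)) 2 ^ 2) - (fderiv ℝ V x (EuclideanSpace.single (0 : Fin 3) (1 : ℝ)) 2 * fderiv ℝ V x (EuclideanSpace.single (2 : Fin 3) (1 : ℝ)) 0 + fderiv ℝ V x (EuclideanSpace.single (1 : Fin 3) (1 : ℝ)) 2 * fderiv ℝ V x (EuclideanSpace.single (2 : Fin 3) (1 : ℝ)) 1))) - (∫ x, w (x 2) * ((3 /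 2) * (fderiv ℝ V x (EuclideanSpace.single (2 : Fin 3) (1 : ℝ)) 0 ^ 2 + fderiv ℝ V x (EuclideanSpace.single (2 : Fin 3) (1 : ℝ)) 1 ^ 2) + (1 / 2) * (fderiv ℝ V x (EuclideanSpace.single (0 : Fin 3) (1 : ℝ)) 0 ^ 2 + fderiv ℝ V x (EuclideanSpace.single (1 : Fin 3) (1 : ℝ)) 0 ^ 2 + fderiv ℝ V x (EuclideanSpace.single (0 : Fin 3) (1 : ℝ)) 1 ^ 2 + fderiv ℝ V x (EuclideanSpace.single (1 : Fin 3) (1 : ℝ)) 1 ^ 2) - (1 / 2) * fderiv ℝ V x (EuclideanSpace.single (2 : Fin 3) (1 : ℝ)) 2 ^ 2 - (1 / 2) * (fderiv ℝ V x (EuclideanSpace.single (0 : Fin 3) (1 : ℝ)) 2 ^ 2 + fderiv ℝ V x (EuclideanSpace.single (1 : Fin 3) (1 : ℝ)) 2 ^ 2) - (fderiv ℝ V x (EuclideanSpace.single (0 : Fin 3) (1 : ℝ)) 2 * fderiv ℝ V x (EuclideanSpace.single (2 : Fin 3) (1 : ℝ)) 0 + fderiv ℝ V x (EuclideanSpace.single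 (1 : Fin 3) (1 : ℝ)) 2 * fderiv ℝ V x (EuclideanSpace.single (2 : Fin 3) (1 : ℝ)) 1))) =
      ∫ x, (w (x 2) * ((3 / 2) * (fderiv ℝ V x (EuclideanSpace.single (2 : Fin 3) (1 : ℝ)) 0 ^ 2 + fderiv ℝ V x (EuclideanSpace.single (2 : Fin 3) (1 : ℝ)) 1 ^ 2) + (1 / 2) * curl V x 2 ^ 2 - (1 / 2) * (fderiv ℝ V x (EuclideanSpace.single (0 : Fin 3) (1 : ℝ)) 2 ^ 2 + fderiv ℝ V x (EuclideanSpace.single (1 : Fin 3) (1 : ℝ)) 2 ^ 2) - (fderiv ℝ V x (EuclideanSpace.single (0 : Fin 3) (1 : ℝ)) 2 * fderiv ℝ V x (EuclideanSpace.single (2 : Fin 3) (1 : ℝ)) 0 + fderiv ℝ V x (EuclideanSpace.single (1 : Fin 3) (1 : ℝ)) 2 * fderiv ℝ V x (EuclideanSpace.single (2 : Fin 3) (1 : ℝ)) 1)) - w (x 2) * ((3 / 2) * (fderiv ℝ V x (EuclideanSpace.single (2 : Fin 3) (1 : ℝ)) 0 ^ 2 + fderiv ℝ V x (EuclideanSpace.single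 (2 : Fin 3) (1 : ℝ)) 1 ^ 2) + (1 / 2) * (fderiv ℝ V x (EuclideanSpace.single (0 : Fin 3) (1 : ℝ)) 0 ^ 2 + fderiv ℝ V x (EuclideanSpace.single (1 : Fin 3) (1 : ℝ)) 0 ^ 2 + fderiv ℝ V x (EuclideanSpace.single (0 : Fin 3) (1 : ℝ)) 1 ^ 2 + fderiv ℝ V x (EuclideanSpace.single (1 : Fin 3) (1 : ℝ)) 1 ^ 2) - (1 / 2) * fderiv ℝ V x (EuclideanSpace.single (2 : Fin 3) (1 : ℝ)) 2 ^ 2 - (1 / 2) * (fderiv ℝ V x (EuclideanSpace.single (0 : Fin 3) (1 : ℝ)) 2 ^ 2 + fderiv ℝ V x (EuclideanSpace.single (1 : Fin 3) (1 : ℝ)) 2 ^ 2) - (fderiv ℝ V x (EuclideanSpace.single (0 : Fin 3) (1 : ℝ)) 2 * fderiv ℝ V x (EuclideanSpace.single (2 : Fin 3) (1 : ℝ)) 0 + fderiv ℝ V x (EuclideanSpace.single (1 : Fin 3) (1 : ℝ)) 2 * fderiv ℝ V x (EuclideanSpace.single (2 : Fin 3) (1 : ℝ)) 1))) := (integral_sub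 iL iR).symm
  have e2 : (∫ x, (w (x 2) * ((3 / 2) * (fderiv ℝ V x (EuclideanSpace.single (2 : Fin 3) (1 : ℝ)) 0 ^ 2 + fderiv ℝ V x (EuclideanSpace.single (2 : Fin 3) (1 : ℝ)) 1 ^ 2) + (1 / 2) * curl V x 2 ^ 2 - (1 / 2) * (fderiv ℝ V x (EuclideanSpace.single (0 : Fin 3) (1 : ℝ)) 2 ^ 2 + fderiv ℝ V x (EuclideanSpace.single (1 : Fin 3) (1 : ℝ)) 2 ^ 2) - (fderiv ℝ V x (EuclideanSpace.single (0 : Fin 3) (1 : ℝ)) 2 * fderiv ℝ V x (EuclideanSpace.single (2 : Fin 3) (1 : ℝ)) 0 + fderiv ℝ V x (EuclideanSpace.single (1 : Fin 3) (1 : ℝ)) 2 * fderiv ℝ V x (EuclideanSpace.single (2 : Fin 3) (1 : ℝ)) 1)) - w (x 2) * ((3 / 2) * (fderiv ℝ V x (EuclideanSpace.single (2 : Fin 3) (1 : ℝ)) 0 ^ 2 + fderiv ℝ V x (EuclideanSpace.single (2 : Fin 3) (1 : ℝ)) 1 ^ 2) + (1 / 2) * (fderiv ℝ V x (EuclideanSpace.single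 (0 : Fin 3) (1 : ℝ)) 0 ^ 2 + fderiv ℝ V x (EuclideanSpace.single (1 : Fin 3) (1 : ℝ)) 0 ^ 2 + fderiv ℝ V x (EuclideanSpace.single (0 : Fin 3) (1 : ℝ)) 1 ^ 2 + fderiv ℝ V x (EuclideanSpace.single (1 : Fin 3) (1 : ℝ)) 1 ^ 2) - (1 / 2) * fderiv ℝ V x (EuclideanSpace.single (2 : Fin 3) (1 : ℝ)) 2 ^ 2 - (1 / 2) * (fderiv ℝ V x (EuclideanSpace.single (0 : Fin 3) (1 : ℝ)) 2 ^ 2 + fderiv ℝ V x (EuclideanSpace.single (1 : Fin 3) (1 : ℝ)) 2 ^ 2) - (fderiv ℝ V x (EuclideanSpace.single (0 : Fin 3) (1 : ℝ)) 2 * fderiv ℝ V x (EuclideanSpace.single (2 : Fin 3) (1 : ℝ)) 0 + fderiv ℝ V x (EuclideanSpace.single (1 : Fin 3) (1 : ℝ)) 2 * fderiv ℝ V x (EuclideanSpace.single (2 : Fin 3) (1 : ℝ)) 1)))) =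
      ∫ x, ((1 / 2) * (w (x 2) * curl V x 2 ^ 2) - (1 / 2) * (w (x 2) * (fderiv ℝ V x (EuclideanSpace.single (0 : Fin 3) (1 : ℝ)) 0 ^ 2 + fderiv ℝ V x (EuclideanSpace.single (1 : Fin 3) (1 : ℝ)) 0 ^ 2 + fderiv ℝ V x (EuclideanSpace.single (0 : Fin 3) (1 : ℝ)) 1 ^ 2 + fderiv ℝ V x (EuclideanSpace.single (1 : Fin 3) (1 : ℝ)) 1 ^ 2)) + (1 / 2) * (w (x 2) * fderiv ℝ V x (EuclideanSpace.single (2 : Fin 3) (1 : ℝ)) 2 ^ 2)) :=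
    integral_congr_ae (Eventually.of_forall fun x => by simp only; ring)
  have f1 : Integrable (fun x : EuclideanSpace ℝ (Fin 3) => (1 / 2) * (w (x 2) * curl V x 2 ^ 2)) volume := hω.const_mul _
  have f2 : Integrable (fun x : EuclideanSpace ℝ (Fin 3) => (1 / 2) * (w (x 2) * (fderiv ℝ V x (EuclideanSpace.single (0 : Fin 3) (1 : ℝ)) 0 ^ 2 + fderiv ℝ V x (EuclideanSpace.single (1 : Fin 3) (1 : ℝ)) 0 ^ 2 + fderiv ℝ V x (EuclideanSpace.single (0 : Fin 3) (1 : ℝ)) 1 ^ 2 + fderiv ℝ V x (EuclideanSpace.single (1 : Fin 3) (1 : ℝ)) 1 ^ 2))) volume := i4.const_mul _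
  have f3 : Integrable (fun x : EuclideanSpace ℝ (Fin 3) => (1 / 2) * (w (x 2) * fderiv ℝ V x (EuclideanSpace.single (2 : Fin 3) (1 : ℝ)) 2 ^ 2)) volume := (hsq 2 2).const_mul _
  have f12 : Integrable (fun x : EuclideanSpace ℝ (Fin 3) => (1 / 2) * (w (x 2) * curl V x 2 ^ 2) - (1 / 2) * (w (x 2) * (fderiv ℝ V x (EuclideanSpace.single (0 : Fin 3) (1 : ℝ)) 0 ^ 2 + fderiv ℝ V x (EuclideanSpace.single (1 : Fin 3) (1 : ℝ)) 0 ^ 2 + fderiv ℝ V x (EuclideanSpace.single (0 : Fin 3) (1 : ℝ)) 1 ^ 2 + fderiv ℝ V x (EuclideanSpace.single (1 : Fin 3) (1 : ℝ)) 1 ^ 2))) volume := f1.sub f2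
  have e3 := integral_add f12 f3
  have e4 := integral_sub f1 f2
  have e5 : (∫ x, (1 / 2) * (w (x 2) * curl V x 2 ^ 2)) = (1 / 2) * ∫ x, w (x 2) * curl V x 2 ^ 2 := integral_const_mul _ _
  have e6 : (∫ x, (1 / 2) * (w (x 2) * (fderiv ℝ V x (EuclideanSpace.single (0 : Fin 3) (1 : ℝ)) 0 ^ 2 + fderiv ℝ V x (EuclideanSpace.single (1 : Fin 3) (1 : ℝ)) 0 ^ 2 + fderiv ℝ V x (EuclideanSpace.single (0 : Fin 3) (1 : ℝ)) 1 ^ 2 + fderiv ℝ V x (EuclideanSpace.single (1 : Fin 3) (1 : ℝ)) 1 ^ 2))) = (1 / 2) * ∫ x, w (x 2) * (fderiv ℝ V x (EuclideanSpace.single (0 : Fin 3) (1 : ℝ)) 0 ^ 2 + fderiv ℝ V x (EuclideanSpace.single (1 : Fin 3) (1 : ℝ)) 0 ^ 2 + fderiv ℝ V x (EuclideanSpace.single (0 : Fin 3) (1 : ℝ)) 1 ^ 2 + fderiv ℝ V x (EuclideanSpace.single (1 : Fin 3) (1 : ℝ)) 1 ^ 2) := integral_const_mul _ _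
  have e7 : (∫ x, (1 / 2) * (w (x 2) * fderiv ℝ V x (EuclideanSpace.single (2 : Fin 3) (1 : ℝ)) 2 ^ 2)) = (1 / 2) * ∫ x, w (x 2) * fderiv ℝ V x (EuclideanSpace.single (2 : Fin 3) (1 : ℝ)) 2 ^ 2 := integral_const_mul _ _
  rw [e2, e3, e4, e5, e6, e7, hplanar] at e1
  linarith

end ExtremiserLiouville

end Summit.NavierStokesRegularity.NavierStokesRegularity.Theorems

end
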